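import Summits.HodgeConjecture.CorCM.MumfordTateRankSurfaceTimesTwoCurves
import Summits.HodgeConjecture.CorCM.MumfordTateRankSimpleSurfacePairs
import Summits.HodgeConjecture.CorCM.MumfordTateRankDuplicateFactor
import HarnessLib

/-!
# Elliptic CURVE × two simple abelian SURFACES (the fivefold partition `{1,2,2}`): `t(E × S × S') + 2 = t(E) + t(S) + t(S')` whenever `S ≁ S'`,
# `t(E × S × S') = t(E × S)` when `S ∼ S'`; `t ∈ {4, …, 18, 20, 22, 24}` (Moonen–Zarhin 1999 §§2–3, (5.4)–(5.5))

COR-CM (cell `pub-hodgecm2`, seat `b27` gen 49, count-neutral Mumford–Tate-rank ladder; theorems only, no definition, no named fact;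
UNCONDITIONAL — nothing here uses or asserts HC_CM).  Notation `t(X) = dim MT(H¹X)`.

For `X ∼ E × (S × S')`, `E` an elliptic curve, `S, S'` SIMPLE abelian surfaces:
* `S ∼ S'`: a duplicate factor, `t(X) = t(E × S) ∈ {4, 5, 6, 7, 8, 10, 12, 14}` (`CorCM/MumfordTateRankDuplicateFactor`, the threefold rows);
* `S ≁ S'`: **`t(X) + 2 = t(E) + t(S) + t(S')`** (`Hg(E × S × S') = Hg(E) × Hg(S) × Hg(S')`) — both surfaces non-CM: `Hg(S × S') = Hg(S) × Hg(S')` has no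
  factor of type IV, then `+1` (CM curve, Thm. (3.2)(2)) or `+3` (non-CM curve, `Hom(S × S', E) = 0`, Lemma (3.4)); `S` CM, `S'` not: `X ∼ (E × S') × S` resp.
  `S' × (E × S)` and Thm. (3.2)(2); both CM: `t(S × S') = 5` (seat b23 transported) `+ 3`, resp. the all-CM census `= 6`.
* `mtRank_hodge_one_mem_of_isIsogenous_curve_prod_simpleSurfaces` — `t(X) ∈ {4, …, 18, 20, 22, 24}`.

## References
* [MoonenZarhin1999LowDim] B. Moonen, Yu. G. Zarhin, *Hodge classes on abelian varieties of low dimension*, Math. Ann. 315 (1999), Thm. (0.1) (4), §2 (2.2), §3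
  Thm. (3.2)(2), Lemma (3.4), §5 (5.4)–(5.5) [corpus: paper:arxiv-math_9901113 pp. 1, 5–7, 10]. [cite: MoonenZarhin1999LowDim, §3 (3.4) and §5 (5.5)]
* [MumfordAV1970] D. Mumford, *Abelian Varieties* (1970), §19 Thm. 1, Cor. 1–2. [cite: MumfordAV1970, §19 Cor. 2 of Thm. 1]
-/

noncomputable section

open CategoryTheory CategoryTheory.Limits Module

namespace Summit.HodgeConjecture.CorCM

open Literature.AlgebraicGeometry.Motives
open Literature.AlgebraicGeometry.Motives.AbelianVariety
open Literature.AlgebraicGeometry.Motives.HodgeStructure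
open Literature.AlgebraicGeometry.HodgeTheory
open Literature.AlgebraicGeometry.Milne1999 (IsOfCMType isOfCMType_iff_of_isIsogenous isOfCMType_prod_iff hom_eq_zero_of_isSimple_of_not_isIsogenous)

variable [HodgeTensorFacts.{0, 0}] {X : AbelianVariety ℂ} {n : ℕ}

/-! ## §1 The threefold row `E × S`, `S` simple, as a membership -/

/-- **`t(E × S) ∈ {4, 5, 6, 7, 8, 10, 12, 14}` for an elliptic curve `E` and a SIMPLE abelian surface `S`** (`4`: both CM; `5, 8, 12`: CM curve × QM / RM /
`End⁰ = ℚ`; `6`: non-CM curve × CM surface; `7, 10, 14`: non-CM curve × QM / RM / `End⁰ = ℚ`). [cite: MoonenZarhin1999LowDim, §2 (2.2) and §3 Thm. (3.2)(2)] -/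
theorem mtRank_hodge_one_mem_of_isIsogenous_curve_prod_isSimple_surface (hX : IsSmoothProjective n X.X) {E S : AbelianVariety ℂ} (hE1 : E.dim = 1)
    (hSs : S.IsSimple) (hS2 : S.dim = 2) (hXP : IsIsogenous X (E.prod S)) :
    haveI := BettiUniverse.finite hX 1
    (BettiUniverse.hodge exists_isReal_hodgeModel_holds hX 1).mtRank ∈ ({4, 5, 6, 7, 8, 10, 12, 14} : Finset ℕ) := by
  have hS : IsSmoothProjective S.dim S.X := AbelianVariety.isSmoothProjective_holds
  haveI := BettiUniverse.finite hX 1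
  haveI := BettiUniverse.finite hS 1
  simp only [Finset.mem_insert, Finset.mem_singleton]
  by_cases hEcm : IsOfCMType E <;> by_cases hScm : IsOfCMType S
  · have h := mtRank_hodge_one_eq_four_of_isIsogenous_cmCurve_prod_cmSurface hX hE1 hEcm hSs hS2 hScm hXP; omega
  · rcases mtRank_hodge_one_of_isIsogenous_cmCurve_prod_isSimple_surface hX hE1 hEcm hSs hS2 hScm hXP with ⟨-, h⟩ | ⟨-, h⟩ | ⟨-, h⟩ <;> omega
  · have h := mtRank_hodge_one_eq_six_of_isIsogenous_curve_prod_cmSurface hX hE1 hEcm hSs hS2 hScm hXP; omega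
  · rcases mtRank_hodge_one_of_isSimple_surface_sharp hS hSs hS2 with ⟨h1, -⟩ | ⟨h2, -⟩ | ⟨-, -, hcm', -⟩ | ⟨h4, -, -⟩
    · have h := mtRank_hodge_one_eq_fourteen_of_isIsogenous_curve_prod_surface_endRankOne hX hE1 hEcm hS2 h1 hXP; omega
    · have h := mtRank_hodge_one_eq_ten_of_isIsogenous_curve_prod_rmSurface hX hE1 hEcm hSs hS2 h2 hXP; omega
    · exact absurd hcm' hScm
    · have h := mtRank_hodge_one_eq_seven_of_isIsogenous_curve_prod_qmSurface hX hE1 hEcm hSs hS2 h4 hScm hXP; omega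

/-! ## §2 `E × S × S'` -/

/-- **Isogenous surfaces: `t(E × S × S') = t(E × S)`** (a duplicate simple factor). [cite: MoonenZarhin1999LowDim, §1 and §3] -/
theorem mtRank_hodge_one_eq_of_isIsogenous_curve_prod_simpleSurfaces_of_isIsogenous (hX : IsSmoothProjective n X.X) {E S S' : AbelianVariety ℂ}
    (hE1 : E.dim = 1) (hSS' : IsIsogenous S S') (hXP : IsIsogenous X (E.prod (S.prod S'))) :
    haveI := BettiUniverse.finite hX 1
    haveI := BettiUniverse.finite (AbelianVariety.isSmoothProjective_holds (A := E.prod S)) 1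
    (BettiUniverse.hodge exists_isReal_hodgeModel_holds hX 1).mtRank =
      (BettiUniverse.hodge exists_isReal_hodgeModel_holds (AbelianVariety.isSmoothProjective_holds (A := E.prod S)) 1).mtRank := by
  have hXQ : IsIsogenous X ((E.prod S).prod S) :=
    (hXP.trans ((IsIsogenous.refl E).prod ((IsIsogenous.refl S).prod hSS'.symm'))).trans (Summit.HodgeConjecture.CorCM.isIsogenous_prod_assoc E S S)
  exact mtRank_hodge_one_eq_of_isIsogenous_prod_prod_self hX (AbelianVariety.isSmoothProjective_holds (A := E.prod S)) (by rw [dim_prod]; omega)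
    hXQ (IsIsogenous.refl _)

/-- **Non-isogenous simple surfaces: `t(E × S × S') + 2 = t(E) + t(S) + t(S')`** for every elliptic curve `E` (`Hg(E × S × S') = Hg(E) × Hg(S) × Hg(S')`).
[cite: MoonenZarhin1999LowDim, Thm. (0.1) (4), §3 Thm. (3.2)(2), (3.4) and §5 (5.5)] [cite: MumfordAV1970, §19 Cor. 2 of Thm. 1] -/
theorem mtRank_hodge_one_add_two_eq_of_isIsogenous_curve_prod_simpleSurfaces_of_not_isIsogenous (hX : IsSmoothProjective n X.X)
    {E S S' : AbelianVariety ℂ} {j k l : ℕ} (hE : IsSmoothProjective j E.X) (hS : IsSmoothProjective k S.X) (hS' : IsSmoothProjective l S'.X)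
    (hE1 : E.dim = 1) (hSs : S.IsSimple) (hS2 : S.dim = 2) (hS's : S'.IsSimple) (hS'2 : S'.dim = 2) (hSS' : ¬ IsIsogenous S S')
    (hXP : IsIsogenous X (E.prod (S.prod S'))) :
    haveI := BettiUniverse.finite hX 1
    haveI := BettiUniverse.finite hE 1
    haveI := BettiUniverse.finite hS 1
    haveI := BettiUniverse.finite hS' 1
    (BettiUniverse.hodge exists_isReal_hodgeModel_holds hX 1).mtRank + 2 =
      (BettiUniverse.hodge exists_isReal_hodgeModel_holds hE 1).mtRank + (BettiUniverse.hodge exists_isReal_hodgeModel_holds hS 1).mtRank +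
        (BettiUniverse.hodge exists_isReal_hodgeModel_holds hS' 1).mtRank := by
  classical
  have hjE : E.dim = j := schemeDim_eq_holds hE
  have hkS : S.dim = k := schemeDim_eq_holds hS
  have hlS : S'.dim = l := schemeDim_eq_holds hS'
  subst hjE hkS hlS
  haveI := BettiUniverse.finite hX 1
  haveI := BettiUniverse.finite hE 1
  haveI := BettiUniverse.finite hS 1
  haveI := BettiUniverse.finite hS' 1
  -- `t(E) = 2` or `4`
  have htE : (IsOfCMType E → (BettiUniverse.hodge exists_isReal_hodgeModel_holds hE 1).mtRank = 2) ∧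
      (¬ IsOfCMType E → (BettiUniverse.hodge exists_isReal_hodgeModel_holds hE 1).mtRank = 4) :=
    ⟨fun h => mtRank_hodge_one_eq_two_of_cm_curve hE1 h, fun h => (curve_facts_of_not_isOfCMType hE1 h).1⟩
  -- symmetric treatment of one CM surface and one non-CM surface
  have hmixed : ∀ {S S' : AbelianVariety ℂ} (hS : IsSmoothProjective S.dim S.X) (hS' : IsSmoothProjective S'.dim S'.X),
      S.IsSimple → S.dim = 2 → S'.IsSimple → S'.dim = 2 → IsOfCMType S → ¬ IsOfCMType S' → IsIsogenous X (E.prod (S.prod S')) →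
      haveI := BettiUniverse.finite hS 1
      haveI := BettiUniverse.finite hS' 1
      (BettiUniverse.hodge exists_isReal_hodgeModel_holds hX 1).mtRank + 2 =
        (BettiUniverse.hodge exists_isReal_hodgeModel_holds hE 1).mtRank + (BettiUniverse.hodge exists_isReal_hodgeModel_holds hS 1).mtRank +
          (BettiUniverse.hodge exists_isReal_hodgeModel_holds hS' 1).mtRank := by
    intro S S' hS hS' hSs hS2 hS's hS'2 hScm hS'cm hXP
    haveI := BettiUniverse.finite hS 1
    haveI := BettiUniverse.finite hS' 1
    have h3 := (isOfCMType_iff_mtRank_hodge_one_eq_three_of_isSimple_surface hS hSs hS2).1 hScm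
    have hS'4 : HasNoTypeIVFactor S' := hasNoTypeIVFactor_of_isSimple_surface_of_not_isOfCMType hS's hS'2 hS'cm
    by_cases hEcm : IsOfCMType E
    · -- `X ∼ S' × (E × S)`, `S'` without type IV, `E × S` of CM type
      have hA := AbelianVariety.isSmoothProjective_holds (A := E.prod S)
      haveI := BettiUniverse.finite hA 1
      have hXQ : IsIsogenous X (S'.prod (E.prod S)) :=
        ((hXP.trans (Summit.HodgeConjecture.CorCM.isIsogenous_prod_assoc E S S')).trans
          (Literature.AlgebraicGeometry.HodgeTheory.isIsogenous_prod_comm (E.prod S) S'))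
      have h := mtRank_hodge_one_add_one_eq_add_of_isIsogenous_prod hX hS' hA (by omega) (by rw [dim_prod]; omega) hS'4
        (isOfCMType_prod_iff.2 ⟨hEcm, hScm⟩) hXQ
      have h4 := mtRank_hodge_one_eq_four_of_isIsogenous_cmCurve_prod_cmSurface hA hE1 hEcm hSs hS2 hScm (IsIsogenous.refl _)
      have h2 := htE.1 hEcm
      omega
    · -- `X ∼ (E × S') × S`, `E × S'` without type IV, `S` of CM type
      have hA := AbelianVariety.isSmoothProjective_holds (A := E.prod S')
      haveI := BettiUniverse.finite hA 1
      obtain ⟨g, hg⟩ := Literature.AlgebraicGeometry.HodgeTheory.isIsogenous_prod_comm S S'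
      have hXQ : IsIsogenous X ((E.prod S').prod S) :=
        (hXP.trans ⟨prodMap (𝟙 E) g, isIsogeny_prodMap (isIsogeny_id _) hg⟩).trans (Summit.HodgeConjecture.CorCM.isIsogenous_prod_assoc E S' S)
      have hE4 : HasNoTypeIVFactor E := (curve_facts_of_not_isOfCMType hE1 hEcm).2.2.1
      have h := mtRank_hodge_one_add_one_eq_add_of_isIsogenous_prod hX hA hS (by rw [dim_prod]; omega) (by omega) (hE4.prod hS'4) hScm hXQ
      have hS'E : ∀ u : S' ⟶ E, u = 0 := fun u => hom_eq_zero_of_isSimple_of_not_isIsogenous hS's (isSimple_of_dim_le_one hE1.le)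
        (fun h => by have hd : S'.dim = E.dim := dim_eq_of_isIsogenous_holds h; omega) u
      have h3' := mtRank_hodge_one_eq_add_three_of_isIsogenous_nonCMCurve_prod hA hS' (by omega) hE1 hEcm hS'E (IsIsogenous.refl _)
      have h4 := htE.2 hEcm
      omega
  by_cases hScm : IsOfCMType S <;> by_cases hS'cm : IsOfCMType S'
  · -- both CM
    have h3 := (isOfCMType_iff_mtRank_hodge_one_eq_three_of_isSimple_surface hS hSs hS2).1 hScm
    have h3' := (isOfCMType_iff_mtRank_hodge_one_eq_three_of_isSimple_surface hS' hS's hS'2).1 hS'cm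
    by_cases hEcm : IsOfCMType E
    · have hXQ : IsIsogenous X (S.prod (S'.prod E)) :=
        (hXP.trans (Literature.AlgebraicGeometry.HodgeTheory.isIsogenous_prod_comm E (S.prod S'))).trans
          (Literature.AlgebraicGeometry.HodgeTheory.isIsogenous_prod_assoc S S' E)
      have h6 := (mtRank_hodge_one_eq_six_of_isIsogenous_cmSurfaces_prod_prod_cmCurve hX hSs hS2 hScm hS's hS'2 hS'cm hSS' hE1 hEcm hXQ).1
      have h2 := htE.1 hEcm
      omega
    · have hP := AbelianVariety.isSmoothProjective_holds (A := S.prod S')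
      haveI := BettiUniverse.finite hP 1
      have hE4 : HasNoTypeIVFactor E := (curve_facts_of_not_isOfCMType hE1 hEcm).2.2.1
      have h := mtRank_hodge_one_add_one_eq_add_of_isIsogenous_prod hX hE hP (by omega) (by rw [dim_prod]; omega) hE4
        (isOfCMType_prod_iff.2 ⟨hScm, hS'cm⟩) hXP
      have h5 := mtRank_hodge_one_eq_five_of_isIsogenous_prod_cmSurfaces_of_not_isIsogenous hP hSs hS2 hScm hS's hS'2 hS'cm hSS' (IsIsogenous.refl _)
      have h4 := htE.2 hEcm
      omega
  · exact hmixed hS hS' hSs hS2 hS's hS'2 hScm hS'cm hXP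
  · obtain ⟨g, hg⟩ := Literature.AlgebraicGeometry.HodgeTheory.isIsogenous_prod_comm S S'
    have h := hmixed hS' hS hS's hS'2 hSs hS2 hS'cm hScm (hXP.trans ⟨prodMap (𝟙 E) g, isIsogeny_prodMap (isIsogeny_id _) hg⟩)
    omega
  · -- both non-CM: `S × S'` has no factor of type IV, `t(S × S') + 1 = t(S) + t(S')`
    have hP := AbelianVariety.isSmoothProjective_holds (A := S.prod S')
    haveI := BettiUniverse.finite hP 1
    have hP4 : HasNoTypeIVFactor (S.prod S') :=
      (hasNoTypeIVFactor_of_isSimple_surface_of_not_isOfCMType hSs hS2 hScm).prod (hasNoTypeIVFactor_of_isSimple_surface_of_not_isOfCMType hS's hS'2 hS'cm)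
    have hPst := (mtRank_hodge_one_of_isIsogenous_prod_simpleSurfaces hP hS hS' hSs hS2 hS's hS'2 (IsIsogenous.refl _)).2 hSS'
    by_cases hEcm : IsOfCMType E
    · have h := mtRank_hodge_one_eq_add_one_of_isIsogenous_cmCurve_prod hX hP hE1 hEcm (by rw [dim_prod]; omega) hP4 hXP
      have h2 := htE.1 hEcm
      omega
    · have hPE : ∀ u : S.prod S' ⟶ E, u = 0 :=
        forall_hom_prod_eq_zero
          (fun v => hom_eq_zero_of_isSimple_of_not_isIsogenous hSs (isSimple_of_dim_le_one hE1.le)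
            (fun h => by have hd : S.dim = E.dim := dim_eq_of_isIsogenous_holds h; omega) v)
          (fun w => hom_eq_zero_of_isSimple_of_not_isIsogenous hS's (isSimple_of_dim_le_one hE1.le)
            (fun h => by have hd : S'.dim = E.dim := dim_eq_of_isIsogenous_holds h; omega) w)
      have h := mtRank_hodge_one_eq_add_three_of_isIsogenous_nonCMCurve_prod hX hP (by rw [dim_prod]; omega) hE1 hEcm hPE hXP
      have h4 := htE.2 hEcm
      omega

/-- **THE FIVEFOLD PARTITION `{1,2,2}`: `t(E × S × S') ∈ {4, 5, 6, 7, 8, 9, 10, 11, 12, 13, 14, 15, 16, 17, 18, 20, 22, 24}`** for an elliptic curve `E` and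
simple abelian surfaces `S, S'` (`t(E) ∈ {2, 4}`, `t(S), t(S') ∈ {3, 4, 7, 11}`; isogenous surfaces give the threefold row `t(E × S)`).
[cite: MoonenZarhin1999LowDim, §2 (2.2), §3 and §5 (5.4)–(5.5)] -/
theorem mtRank_hodge_one_mem_of_isIsogenous_curve_prod_simpleSurfaces (hX : IsSmoothProjective n X.X) {E S S' : AbelianVariety ℂ} (hE1 : E.dim = 1)
    (hSs : S.IsSimple) (hS2 : S.dim = 2) (hS's : S'.IsSimple) (hS'2 : S'.dim = 2) (hXP : IsIsogenous X (E.prod (S.prod S'))) :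
    haveI := BettiUniverse.finite hX 1
    (BettiUniverse.hodge exists_isReal_hodgeModel_holds hX 1).mtRank ∈
      ({4, 5, 6, 7, 8, 9, 10, 11, 12, 13, 14, 15, 16, 17, 18, 20, 22, 24} : Finset ℕ) := by
  have hE : IsSmoothProjective E.dim E.X := AbelianVariety.isSmoothProjective_holds
  have hS : IsSmoothProjective S.dim S.X := AbelianVariety.isSmoothProjective_holds
  have hS' : IsSmoothProjective S'.dim S'.X := AbelianVariety.isSmoothProjective_holds
  have hA := AbelianVariety.isSmoothProjective_holds (A := E.prod S)
  haveI := BettiUniverse.finite hX 1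
  haveI := BettiUniverse.finite hE 1
  haveI := BettiUniverse.finite hS 1
  haveI := BettiUniverse.finite hS' 1
  haveI := BettiUniverse.finite hA 1
  simp only [Finset.mem_insert, Finset.mem_singleton]
  by_cases hSS' : IsIsogenous S S'
  · have h := mtRank_hodge_one_eq_of_isIsogenous_curve_prod_simpleSurfaces_of_isIsogenous hX hE1 hSS' hXP
    have hm := mtRank_hodge_one_mem_of_isIsogenous_curve_prod_isSimple_surface hA hE1 hSs hS2 (IsIsogenous.refl _)
    simp only [Finset.mem_insert, Finset.mem_singleton] at hm
    omega
  · have h := mtRank_hodge_one_add_two_eq_of_isIsogenous_curve_prod_simpleSurfaces_of_not_isIsogenous hX hE hS hS' hE1 hSs hS2 hS's hS'2 hSS' hXP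
    have htE : (BettiUniverse.hodge exists_isReal_hodgeModel_holds hE 1).mtRank = 2 ∨ (BettiUniverse.hodge exists_isReal_hodgeModel_holds hE 1).mtRank = 4 := by
      by_cases hEcm : IsOfCMType E
      · exact Or.inl (mtRank_hodge_one_eq_two_of_cm_curve hE1 hEcm)
      · exact Or.inr (curve_facts_of_not_isOfCMType hE1 hEcm).1
    rcases mtRank_hodge_one_of_isSimple_surface_sharp hS hSs hS2 with ⟨-, h₁⟩ | ⟨-, h₁⟩ | ⟨-, -, -, h₁⟩ | ⟨-, -, h₁⟩ <;>
      rcases mtRank_hodge_one_of_isSimple_surface_sharp hS' hS's hS'2 with ⟨-, h₂⟩ | ⟨-, h₂⟩ | ⟨-, -, -, h₂⟩ | ⟨-, -, h₂⟩ <;> omega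

end Summit.HodgeConjecture.CorCM

end
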